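import Summits.BirchSwinnertonDyer.BirchSwinnertonDyer.Theses.KatoDescentPotSupersingular
import Summits.BirchSwinnertonDyer.BirchSwinnertonDyer.Theorems.KatoDescentPotSupersingularMuCoreIrrConjAThree
import Literature.NumberTheory.EllipticCurves.Kato2004.EulerSystemClassNonvanishingProofs
import Literature.NumberTheory.EllipticCurves.CuspFormLFunctionAnalyticRankProofs
import HarnessLib

/-!
# K9 crux `WildCoatesSujathaResidue` (item stmt-BirchSwinnertonDyer-19942, the Conj-A residue of the U₀-ns node 19189 /
# U₀ parent 19197) BY NAME from Kato's zeta-body inputs {modularity, `exists_eulerSystem_expStar_values`} and ONE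
# pinned, scale-invariant statement about Kato's Λ-adic zeta LINE — CONDITIONAL closer-helper (item stays open)

Seat `bsd-potss-k9-c4` g15 (prover; cell `bsd-potss`); `--supports stmt-BirchSwinnertonDyer-19942 --as helper`; closes
nothing (conditional-result).  HONEST FRAMING: BSD is not proved by any of this; Conjecture A is NOT proved; nothing is
booked.  This is the kernel content of plan g25's split kit for 19942 (`HOME/plan/rekey-g25/SPLITKIT-19942-19916-spec.md`)
with its child 2 CORRECTED: the spec's pin «every non-zero Λ-adic lift of every zeta body lies outside `3·𝐇¹_Γ`» is
false on every row (the zeta-body matrix is homogeneous, `ZetaBodyScaling.zetaBody_smul`; kernel obstruction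
`ZetaLineScaling.not_forall_zetaBody_lift_not_mem`, this seat), so the third hypothesis below is the SCALE-INVARIANT
form «for every admissible zeta body of `W` at `3` and every non-zero lift `y`, some genuine Euler-system class
`s ∉ 3·𝐇¹_Γ` has `3^k • s = y`» — the `3`-indivisible generator of the `3`-saturated zeta line is an Euler-system
class («`μ₃` of Kato's zeta class `= 0`» read on the LINE the tree pins, `IwasawaH1Data.existsUnique_lift_of_zetaBody`).
The proof: modularity gives the newform; the construction fact gives a zeta body for one admissible guarded datum
(`valueGuard_satisfiable`); its unique Λ-adic lift is a genuine Euler-system class (`exists_isEulerSystemClass_of_zetaBody`),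
non-zero because `L(W,1) ≠ 0` (`r_an = 0`, `IsNewformOf.hasEntireLFunction`, `analyticRank_eq_zero_iff_holds`,
`zetaBody_bottom_ne_zero`, `lift_ne_zero_of_bottom_ne_zero`); the third hypothesis yields `s`; k9-c4 g14's
UNCONDITIONAL `μ`-core `MuCoreIrr.exists_fineSelmerDualData_moduleFinite_three_of_irr_of_eulerClass` concludes.  The
route decl's other row conditions (O6, tower not onto, optimal member) are passed through unused.

References: [Kato2004Asterisque] §13.1, Thm. 13.4 (pp. 224–226), Ex. 13.3 (p. 225), Thm. 12.5 (1) (pp. 221–222),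
§13.8; [CoatesSujatha2005] Conjecture A; [BreuilConradDiamondTaylor2001] Thm. A; HOME pub/bsd-smallim/koly/MU-TRANSFER-PROOF.md.
-/

-- the summit and its single problem are both named `BirchSwinnertonDyer` (registry layout D-0017)
set_option linter.dupNamespace false
set_option autoImplicit false

noncomputable section

open Field WeierstrassCurve
open Literature.NumberTheory.GaloisRepresentations Literature.NumberTheory.EllipticCurves
open Literature.NumberTheory.EllipticCurves.ModularForms
open Literature.NumberTheory.EllipticCurves.Kato2004 Literature.NumberTheory.EllipticCurves.Kato2004.EulerSystemValues

namespace Summit.BirchSwinnertonDyer.BirchSwinnertonDyer.Theorems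

/-- **`WildCoatesSujathaResidue` (item 19942) from modularity, Kato's zeta Euler system with values, and the
indivisible-generator statement for Kato's zeta line at `3`**, by name: CONDITIONAL closer-helper (the three
hypotheses are, verbatim, `ModularForms.exists_isNewformOf`, `Kato2004.exists_eulerSystem_expStar_values` and the
g15 split-kit child `WildKatoZetaIndivisible`); the item is not closed by this theorem.
[cite: Kato2004Asterisque, §13.1 and Thm. 13.4 (pp. 224–226), Ex. 13.3 (p. 225), Thm. 12.5 (1) (pp. 221–222), §13.8 (pp. 228–229)]
[cite: CoatesSujatha2005, §3 and Conjecture A] [cite: BreuilConradDiamondTaylor2001, Thm. A] -/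
theorem wildCoatesSujathaResidue_of_katoZetaLine (hmod : exists_isNewformOf) (hES : exists_eulerSystem_expStar_values)
    (hZL : ∀ (W : WeierstrassCurve ℚ) [W.IsElliptic] [W.IsGloballyMinimal] [Fact (3 : ℕ).Prime], W.analyticRank = 0 → Summit.BirchSwinnertonDyer.Rank1Residual.Additive.ClassO6 W 3 → W.HasIrreducibleModPGaloisRep 3 → ¬ (∀ n : ℕ, W.HasSurjectiveModNGaloisRep (3 ^ n : ℕ)) → ¬ W.HasCM → (∃ (W₀ : WeierstrassCurve ℚ) (_ : W₀.IsElliptic) (_ : W₀.IsGloballyMinimal) (_ : NeZero (W₀.conductorNorm ℤ)) (D₀ : Literature.NumberTheory.EllipticCurves.ModularForms.ModularParametrizationData W₀ (W₀.conductorNorm ℤ)), WeierstrassCurve.IsIsogenous W W₀ ∧ (∀ z ∈ D₀.L.lattice, ∃ w ∈ Literature.NumberTheory.EllipticCurves.ModularForms.periodLattice D₀.f, z = (D₀.c : ℂ) * w) ∧ ((3 : ℤ) ∣ D₀.c ∨ (3 ∣ W₀.tamagawaProduct ∧ ¬ ∃ (q : ℕ) (_ : Fact q.Prime), q ∣ W₀.conductorNorm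 ℤ ∧ (q ≠ 3 → ¬ q ^ 2 ∣ W₀.conductorNorm ℤ ∧ ¬ 3 ∣ (W₀.baseChange ℚ_[3]).localTamagawaNumber ℤ_[3]) ∧ padicValNat 3 W₀.tamagawaProduct ≤ padicValNat 3 ((W₀.baseChange ℚ_[q]).localTamagawaNumber ℤ_[q])))) → ∀ (h32 : (3 : ℕ) ≠ 2) (κ : Literature.NumberTheory.EllipticCurves.ZpExtension ℚ 3) (hκ : κ.IsCyclotomic) [ContinuousSMul ℤ_[3] (W.tateModule 3)] [Module.Free ℤ_[3] (W.tateModule 3)] [Module.Finite ℤ_[3] (W.tateModule 3)] (γ : Field.absoluteGaloisGroup ℚ) (I : Literature.NumberTheory.EllipticCurves.Kato2004.IwasawaH1Data W 3 κ γ), κ.IsTopGenerator γ → ∀ {N : ℕ} [NeZero N] (f : CuspForm (CongruenceSubgroup.Gamma0 N) 2), Literature.NumberTheory.EllipticCurves.ModularForms.IsNewformOf W f → ∀ (ι : (m : ℕ) → (CyclotomicField m ℚ →+* ℂ)) (κ' : ℝ) (Λ' : ∀ (k : ℕ) (r : Finset (IsDedekindDomain.HeightOneSpectrum (NumberField.RingOfIntegers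 ℚ))), Literature.NumberTheory.GaloisRepresentations.H1 (Literature.NumberTheory.EllipticCurves.Kato2004.EulerSystemValues.tateRep W 3) (Literature.NumberTheory.EllipticCurves.Kato2004.EulerSystemValues.cycSubgroup 3 k r) →ₗ[ℤ_[3]] TensorProduct ℚ ℚ_[3] (CyclotomicField (Literature.NumberTheory.EllipticCurves.Kato2004.EulerSystemValues.cycLevel 3 k r) ℚ)) (c d a : ℤ) (A : ℕ), 0 < A → Int.gcd c (6 * 3 * A) = 1 → Int.gcd d (6 * 3 * N) = 1 → ∀ (z : ∀ (k : ℕ) (r : (Literature.NumberTheory.GaloisRepresentations.cyclotomicLevelsRat 3 (Literature.NumberTheory.EllipticCurves.Kato2004.EulerSystemValues.badPlaces c d A N)).Ideals), Literature.NumberTheory.GaloisRepresentations.H1 (Literature.NumberTheory.EllipticCurves.Kato2004.EulerSystemValues.tateRep W 3) ((Literature.NumberTheory.GaloisRepresentations.cyclotomicLevelsRat 3 (Literature.NumberTheory.EllipticCurves.Kato2004.EulerSystemValues.badPlaces c d A N)).level k r.1)) (x : ∀ (k : ℕ) (r : (Literature.NumberTheory.GaloisRepresentations.cyclotomicLevelsRat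 3 (Literature.NumberTheory.EllipticCurves.Kato2004.EulerSystemValues.badPlaces c d A N)).Ideals), CyclotomicField (Literature.NumberTheory.EllipticCurves.Kato2004.EulerSystemValues.cycLevel 3 k r.1) ℚ), Literature.NumberTheory.EllipticCurves.Kato2004.ZetaBody W 3 f ι κ' Λ' c d a A z x → ∀ (y : I.H), (∀ n : ℕ, I.proj n y = Literature.NumberTheory.EllipticCurves.Kato2004.levelToLayer W 3 hκ h32 (Literature.NumberTheory.EllipticCurves.Kato2004.EulerSystemValues.badPlaces c d A N) n (z (n + 1) (Literature.NumberTheory.GaloisRepresentations.cyclotomicLevelsRat 3 (Literature.NumberTheory.EllipticCurves.Kato2004.EulerSystemValues.badPlaces c d A N)).idealOne)) → y ≠ 0 → ∃ (s : I.H) (k : ℕ), Literature.NumberTheory.EllipticCurves.Kato2004.IsEulerSystemClass W 3 κ γ I s ∧ s ∉ Literature.NumberTheory.EllipticCurves.IwasawaAlgebra.augIdealP 3 • (⊤ : Submodule (Literature.NumberTheory.EllipticCurves.IwasawaAlgebra 3) I.H) ∧ (3 ^ k : ℕ) • s = y) :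
    Summit.BirchSwinnertonDyer.BirchSwinnertonDyer.Theses.KatoDescentPotSupersingular.WildCoatesSujathaResidue := by
  intro W _ _ _ hr hO6 hirr htower hCM hopt κ hκ
  refine MuCoreIrr.exists_fineSelmerDualData_moduleFinite_three_of_irr_of_eulerClass W hirr κ hκ ?_
  intro γ I hγ
  letI : ContinuousSMul ℤ_[3] (W.tateModule 3) := TateModule.continuousSMul_padicInt
  haveI : Module.Free ℤ_[3] (W.tateModule 3) := W.module_free_tateModule_holds 3
  haveI : Module.Finite ℤ_[3] (W.tateModule 3) := W.module_finite_tateModule_holds 3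
  haveI : NeZero (W.conductorNorm ℤ) := ⟨W.conductorNorm_pos_holds.ne'⟩
  have h32 : (3 : ℕ) ≠ 2 := by decide
  -- modularity: the newform of `W`
  obtain ⟨f, hf⟩ := hmod W
  -- Kato's zeta Euler system with values for an admissible guarded datum
  set ι : (m : ℕ) → (CyclotomicField m ℚ →+* ℂ) :=
    fun m ↦ Classical.choice (inferInstance : Nonempty (CyclotomicField m ℚ →+* ℂ)) with hι
  obtain ⟨κ', hκ'0, Λ', hfam⟩ := hES W 3 hirr f hf ι
  obtain ⟨c, d, a, A, d', hA, hc, hd, hcd, hdd', hR⟩ := valueGuard_satisfiable f hf.1 hf.coeffField_eq_bot 3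
  obtain ⟨z, x, hbody⟩ := hfam c d a A hA hc hd
  have hne := two_mul_natAbs_ne_zero_of_guards 3 hA (NeZero.ne (W.conductorNorm ℤ)) hc hd
  -- the unique Λ-adic lift, a genuine Euler-system class
  obtain ⟨y, _hyES, hy⟩ := exists_isEulerSystemClass_of_zetaBody W 3 hκ h32 I f ι κ' Λ' c d a A z x hbody hne
  -- `L(W,1) ≠ 0` from `r_an = 0` (the entire continuation exists by modularity)
  have hL1 : W.entireLFunction 1 ≠ 0 := (W.analyticRank_eq_zero_iff_holds hf.hasEntireLFunction).mp hr
  have hy0 : y ≠ 0 := lift_ne_zero_of_bottom_ne_zero W 3 hκ I h32 (badPlaces c d A (W.conductorNorm ℤ)) hbody.1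
    (zetaBody_bottom_ne_zero hbody hf hκ'0 hL1 hA d' hcd hdd' hR) hy
  -- the `3`-indivisible generator of the saturated zeta line is a genuine Euler-system class
  obtain ⟨s, _k, hsES, hs, _hsy⟩ := hZL W hr hO6 hirr htower hCM hopt h32 κ hκ γ I hγ f hf ι κ' Λ' c d a A hA hc hd z x
    hbody y hy hy0
  exact ⟨s, hsES, hs⟩

/-- **Glue-shaped form** (the closer of the planner's split glue `WildCoatesSujathaResidueOfKatoZeta :
HeldKatoZetaBodyInputs → WildKatoZetaIndivisible → WildCoatesSujathaResidue`, whose first child is the conjunction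
`exists_isNewformOf ∧ exists_eulerSystem_expStar_values`): `(exists_isNewformOf ∧ exists_eulerSystem_expStar_values) →
<child 2> → WildCoatesSujathaResidue`.  Conditional; nothing else assumed.
[cite: Kato2004Asterisque, Ex. 13.3 (p. 225), Thm. 12.5 (1) (pp. 221–222)] [cite: CoatesSujatha2005, Conjecture A] -/
theorem wildCoatesSujathaResidue_of_katoZetaBodyInputs_of_katoZetaLine
    (hIn : (exists_isNewformOf : Prop) ∧ (exists_eulerSystem_expStar_values : Prop))
    (hZL : ∀ (W : WeierstrassCurve ℚ) [W.IsElliptic] [W.IsGloballyMinimal] [Fact (3 : ℕ).Prime], W.analyticRank = 0 → Summit.BirchSwinnertonDyer.Rank1Residual.Additive.ClassO6 W 3 → W.HasIrreducibleModPGaloisRep 3 → ¬ (∀ n : ℕ, W.HasSurjectiveModNGaloisRep (3 ^ n : ℕ)) → ¬ W.HasCM → (∃ (W₀ : WeierstrassCurve ℚ) (_ : W₀.IsElliptic) (_ : W₀.IsGloballyMinimal) (_ : NeZero (W₀.conductorNorm ℤ)) (D₀ : Literature.NumberTheory.EllipticCurves.ModularForms.ModularParametrizationData W₀ (W₀.conductorNorm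 ℤ)), WeierstrassCurve.IsIsogenous W W₀ ∧ (∀ z ∈ D₀.L.lattice, ∃ w ∈ Literature.NumberTheory.EllipticCurves.ModularForms.periodLattice D₀.f, z = (D₀.c : ℂ) * w) ∧ ((3 : ℤ) ∣ D₀.c ∨ (3 ∣ W₀.tamagawaProduct ∧ ¬ ∃ (q : ℕ) (_ : Fact q.Prime), q ∣ W₀.conductorNorm ℤ ∧ (q ≠ 3 → ¬ q ^ 2 ∣ W₀.conductorNorm ℤ ∧ ¬ 3 ∣ (W₀.baseChange ℚ_[3]).localTamagawaNumber ℤ_[3]) ∧ padicValNat 3 W₀.tamagawaProduct ≤ padicValNat 3 ((W₀.baseChange ℚ_[q]).localTamagawaNumber ℤ_[q])))) → ∀ (h32 : (3 : ℕ) ≠ 2) (κ : Literature.NumberTheory.EllipticCurves.ZpExtension ℚ 3) (hκ : κ.IsCyclotomic) [ContinuousSMul ℤ_[3] (W.tateModule 3)] [Module.Free ℤ_[3] (W.tateModule 3)] [Module.Finite ℤ_[3] (W.tateModule 3)] (γ : Field.absoluteGaloisGroup ℚ) (I : Literature.NumberTheory.EllipticCurves.Kato2004.IwasawaH1Data W 3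 κ γ), κ.IsTopGenerator γ → ∀ {N : ℕ} [NeZero N] (f : CuspForm (CongruenceSubgroup.Gamma0 N) 2), Literature.NumberTheory.EllipticCurves.ModularForms.IsNewformOf W f → ∀ (ι : (m : ℕ) → (CyclotomicField m ℚ →+* ℂ)) (κ' : ℝ) (Λ' : ∀ (k : ℕ) (r : Finset (IsDedekindDomain.HeightOneSpectrum (NumberField.RingOfIntegers ℚ))), Literature.NumberTheory.GaloisRepresentations.H1 (Literature.NumberTheory.EllipticCurves.Kato2004.EulerSystemValues.tateRep W 3) (Literature.NumberTheory.EllipticCurves.Kato2004.EulerSystemValues.cycSubgroup 3 k r) →ₗ[ℤ_[3]] TensorProduct ℚ ℚ_[3] (CyclotomicField (Literature.NumberTheory.EllipticCurves.Kato2004.EulerSystemValues.cycLevel 3 k r) ℚ)) (c d a : ℤ) (A : ℕ), 0 < A → Int.gcd c (6 * 3 * A) = 1 → Int.gcd d (6 * 3 * N) = 1 → ∀ (z : ∀ (k : ℕ) (r : (Literature.NumberTheory.GaloisRepresentations.cyclotomicLevelsRat 3 (Literature.NumberTheory.EllipticCurves.Kato2004.EulerSystemValues.badPlaces c d A N)).Ideals),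 Literature.NumberTheory.GaloisRepresentations.H1 (Literature.NumberTheory.EllipticCurves.Kato2004.EulerSystemValues.tateRep W 3) ((Literature.NumberTheory.GaloisRepresentations.cyclotomicLevelsRat 3 (Literature.NumberTheory.EllipticCurves.Kato2004.EulerSystemValues.badPlaces c d A N)).level k r.1)) (x : ∀ (k : ℕ) (r : (Literature.NumberTheory.GaloisRepresentations.cyclotomicLevelsRat 3 (Literature.NumberTheory.EllipticCurves.Kato2004.EulerSystemValues.badPlaces c d A N)).Ideals), CyclotomicField (Literature.NumberTheory.EllipticCurves.Kato2004.EulerSystemValues.cycLevel 3 k r.1) ℚ), Literature.NumberTheory.EllipticCurves.Kato2004.ZetaBody W 3 f ι κ' Λ' c d a A z x → ∀ (y : I.H), (∀ n : ℕ, I.proj n y = Literature.NumberTheory.EllipticCurves.Kato2004.levelToLayer W 3 hκ h32 (Literature.NumberTheory.EllipticCurves.Kato2004.EulerSystemValues.badPlaces c d A N) n (z (n + 1) (Literature.NumberTheory.GaloisRepresentations.cyclotomicLevelsRat 3 (Literature.NumberTheory.EllipticCurves.Kato2004.EulerSystemValues.badPlaces c d A N)).idealOne)) → y ≠ 0 →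 ∃ (s : I.H) (k : ℕ), Literature.NumberTheory.EllipticCurves.Kato2004.IsEulerSystemClass W 3 κ γ I s ∧ s ∉ Literature.NumberTheory.EllipticCurves.IwasawaAlgebra.augIdealP 3 • (⊤ : Submodule (Literature.NumberTheory.EllipticCurves.IwasawaAlgebra 3) I.H) ∧ (3 ^ k : ℕ) • s = y) :
    Summit.BirchSwinnertonDyer.BirchSwinnertonDyer.Theses.KatoDescentPotSupersingular.WildCoatesSujathaResidue :=
  wildCoatesSujathaResidue_of_katoZetaLine hIn.1 hIn.2 hZL

/-! ## Appended (k9-c4 g15): the WEAKER «Λ-multiple» form of the third hypothesis — the child the g15 kit files -/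

/-- **`WildCoatesSujathaResidue` (item 19942) from modularity, Kato's zeta Euler system with values, and «every
non-zero Λ-adic lift of every admissible zeta body of `W` at `3` is a `Λ`-MULTIPLE of a genuine Euler-system class
outside `3·𝐇¹_Γ`»** (the g15 split-kit child `WildKatoZetaIndivisible` in its filed, weakest pinned form; implied by the
saturated-line form via `ZetaLineScaling.zetaMultiple_of_zetaLineSaturated`).  Same proof as
`wildCoatesSujathaResidue_of_katoZetaLine`.  CONDITIONAL; the item is not closed by this theorem.
[cite: Kato2004Asterisque, §13.1 and Thm. 13.4 (pp. 224–226), Ex. 13.3 (p. 225), Thm. 12.5 (1) (pp. 221–222), §13.8 (pp. 228–229)]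
[cite: CoatesSujatha2005, §3 and Conjecture A] [cite: BreuilConradDiamondTaylor2001, Thm. A] -/
theorem wildCoatesSujathaResidue_of_katoZetaMultiple (hmod : exists_isNewformOf)
    (hES : exists_eulerSystem_expStar_values)
    (hZM : ∀ (W : WeierstrassCurve ℚ) [W.IsElliptic] [W.IsGloballyMinimal] [Fact (3 : ℕ).Prime], W.analyticRank = 0 → Summit.BirchSwinnertonDyer.Rank1Residual.Additive.ClassO6 W 3 → W.HasIrreducibleModPGaloisRep 3 → ¬ (∀ n : ℕ, W.HasSurjectiveModNGaloisRep (3 ^ n : ℕ)) → ¬ W.HasCM → (∃ (W₀ : WeierstrassCurve ℚ) (_ : W₀.IsElliptic) (_ : W₀.IsGloballyMinimal) (_ : NeZero (W₀.conductorNorm ℤ)) (D₀ : Literature.NumberTheory.EllipticCurves.ModularForms.ModularParametrizationData W₀ (W₀.conductorNorm ℤ)), WeierstrassCurve.IsIsogenous W W₀ ∧ (∀ z ∈ D₀.L.lattice, ∃ w ∈ Literature.NumberTheory.EllipticCurves.ModularForms.periodLattice D₀.f, z = (D₀.c : ℂ) * w) ∧ ((3 : ℤ) ∣ D₀.c ∨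 (3 ∣ W₀.tamagawaProduct ∧ ¬ ∃ (q : ℕ) (_ : Fact q.Prime), q ∣ W₀.conductorNorm ℤ ∧ (q ≠ 3 → ¬ q ^ 2 ∣ W₀.conductorNorm ℤ ∧ ¬ 3 ∣ (W₀.baseChange ℚ_[3]).localTamagawaNumber ℤ_[3]) ∧ padicValNat 3 W₀.tamagawaProduct ≤ padicValNat 3 ((W₀.baseChange ℚ_[q]).localTamagawaNumber ℤ_[q])))) → ∀ (h32 : (3 : ℕ) ≠ 2) (κ : Literature.NumberTheory.EllipticCurves.ZpExtension ℚ 3) (hκ : κ.IsCyclotomic) [ContinuousSMul ℤ_[3] (W.tateModule 3)] [Module.Free ℤ_[3] (W.tateModule 3)] [Module.Finite ℤ_[3] (W.tateModule 3)] (γ : Field.absoluteGaloisGroup ℚ) (I : Literature.NumberTheory.EllipticCurves.Kato2004.IwasawaH1Data W 3 κ γ), κ.IsTopGenerator γ → ∀ {N : ℕ} [NeZero N] (f : CuspForm (CongruenceSubgroup.Gamma0 N) 2), Literature.NumberTheory.EllipticCurves.ModularForms.IsNewformOf W f → ∀ (ι : (m : ℕ) → (CyclotomicField m ℚ →+* ℂ))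 (κ' : ℝ) (Λ' : ∀ (k : ℕ) (r : Finset (IsDedekindDomain.HeightOneSpectrum (NumberField.RingOfIntegers ℚ))), Literature.NumberTheory.GaloisRepresentations.H1 (Literature.NumberTheory.EllipticCurves.Kato2004.EulerSystemValues.tateRep W 3) (Literature.NumberTheory.EllipticCurves.Kato2004.EulerSystemValues.cycSubgroup 3 k r) →ₗ[ℤ_[3]] TensorProduct ℚ ℚ_[3] (CyclotomicField (Literature.NumberTheory.EllipticCurves.Kato2004.EulerSystemValues.cycLevel 3 k r) ℚ)) (c d a : ℤ) (A : ℕ), 0 < A → Int.gcd c (6 * 3 * A) = 1 → Int.gcd d (6 * 3 * N) = 1 → ∀ (z : ∀ (k : ℕ) (r : (Literature.NumberTheory.GaloisRepresentations.cyclotomicLevelsRat 3 (Literature.NumberTheory.EllipticCurves.Kato2004.EulerSystemValues.badPlaces c d A N)).Ideals), Literature.NumberTheory.GaloisRepresentations.H1 (Literature.NumberTheory.EllipticCurves.Kato2004.EulerSystemValues.tateRep W 3) ((Literature.NumberTheory.GaloisRepresentations.cyclotomicLevelsRat 3 (Literature.NumberTheory.EllipticCurves.Kato2004.EulerSystemValues.badPlaces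 c d A N)).level k r.1)) (x : ∀ (k : ℕ) (r : (Literature.NumberTheory.GaloisRepresentations.cyclotomicLevelsRat 3 (Literature.NumberTheory.EllipticCurves.Kato2004.EulerSystemValues.badPlaces c d A N)).Ideals), CyclotomicField (Literature.NumberTheory.EllipticCurves.Kato2004.EulerSystemValues.cycLevel 3 k r.1) ℚ), Literature.NumberTheory.EllipticCurves.Kato2004.ZetaBody W 3 f ι κ' Λ' c d a A z x → ∀ (y : I.H), (∀ n : ℕ, I.proj n y = Literature.NumberTheory.EllipticCurves.Kato2004.levelToLayer W 3 hκ h32 (Literature.NumberTheory.EllipticCurves.Kato2004.EulerSystemValues.badPlaces c d A N) n (z (n + 1) (Literature.NumberTheory.GaloisRepresentations.cyclotomicLevelsRat 3 (Literature.NumberTheory.EllipticCurves.Kato2004.EulerSystemValues.badPlaces c d A N)).idealOne)) → y ≠ 0 → ∃ (s : I.H) (a : Literature.NumberTheory.EllipticCurves.IwasawaAlgebra 3), Literature.NumberTheory.EllipticCurves.Kato2004.IsEulerSystemClass W 3 κ γ I s ∧ s ∉ Literature.NumberTheory.EllipticCurves.IwasawaAlgebra.augIdealP 3 • (⊤ :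 Submodule (Literature.NumberTheory.EllipticCurves.IwasawaAlgebra 3) I.H) ∧ a • s = y) :
    Summit.BirchSwinnertonDyer.BirchSwinnertonDyer.Theses.KatoDescentPotSupersingular.WildCoatesSujathaResidue := by
  intro W _ _ _ hr hO6 hirr htower hCM hopt κ hκ
  refine MuCoreIrr.exists_fineSelmerDualData_moduleFinite_three_of_irr_of_eulerClass W hirr κ hκ ?_
  intro γ I hγ
  letI : ContinuousSMul ℤ_[3] (W.tateModule 3) := TateModule.continuousSMul_padicInt
  haveI : Module.Free ℤ_[3] (W.tateModule 3) := W.module_free_tateModule_holds 3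
  haveI : Module.Finite ℤ_[3] (W.tateModule 3) := W.module_finite_tateModule_holds 3
  haveI : NeZero (W.conductorNorm ℤ) := ⟨W.conductorNorm_pos_holds.ne'⟩
  have h32 : (3 : ℕ) ≠ 2 := by decide
  -- modularity: the newform of `W`
  obtain ⟨f, hf⟩ := hmod W
  -- Kato's zeta Euler system with values for an admissible guarded datum
  set ι : (m : ℕ) → (CyclotomicField m ℚ →+* ℂ) :=
    fun m ↦ Classical.choice (inferInstance : Nonempty (CyclotomicField m ℚ →+* ℂ)) with hι
  obtain ⟨κ', hκ'0, Λ', hfam⟩ := hES W 3 hirr f hf ι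
  obtain ⟨c, d, a, A, d', hA, hc, hd, hcd, hdd', hR⟩ := valueGuard_satisfiable f hf.1 hf.coeffField_eq_bot 3
  obtain ⟨z, x, hbody⟩ := hfam c d a A hA hc hd
  have hne := two_mul_natAbs_ne_zero_of_guards 3 hA (NeZero.ne (W.conductorNorm ℤ)) hc hd
  -- the unique Λ-adic lift, a genuine Euler-system class
  obtain ⟨y, _hyES, hy⟩ := exists_isEulerSystemClass_of_zetaBody W 3 hκ h32 I f ι κ' Λ' c d a A z x hbody hne
  -- `L(W,1) ≠ 0` from `r_an = 0` (the entire continuation exists by modularity)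
  have hL1 : W.entireLFunction 1 ≠ 0 := (W.analyticRank_eq_zero_iff_holds hf.hasEntireLFunction).mp hr
  have hy0 : y ≠ 0 := lift_ne_zero_of_bottom_ne_zero W 3 hκ I h32 (badPlaces c d A (W.conductorNorm ℤ)) hbody.1
    (zetaBody_bottom_ne_zero hbody hf hκ'0 hL1 hA d' hcd hdd' hR) hy
  -- the `3`-indivisible generator of the saturated zeta line is a genuine Euler-system class
  obtain ⟨s, _a, hsES, hs, _hsy⟩ := hZM W hr hO6 hirr htower hCM hopt h32 κ hκ γ I hγ f hf ι κ' Λ' c d a A hA hc hd z x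
    hbody y hy hy0
  exact ⟨s, hsES, hs⟩

/-- **Glue-shaped form** of `wildCoatesSujathaResidue_of_katoZetaMultiple` (closer of the planner's split glue
`WildCoatesSujathaResidueOfKatoZeta : HeldKatoZetaBodyInputs → WildKatoZetaIndivisible → WildCoatesSujathaResidue` with the
multiple-form child).  Conditional; nothing else assumed.
[cite: Kato2004Asterisque, Ex. 13.3 (p. 225), Thm. 12.5 (1) (pp. 221–222)] [cite: CoatesSujatha2005, Conjecture A] -/
theorem wildCoatesSujathaResidue_of_katoZetaBodyInputs_of_katoZetaMultiple
    (hIn : (exists_isNewformOf : Prop) ∧ (exists_eulerSystem_expStar_values : Prop))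
    (hZM : ∀ (W : WeierstrassCurve ℚ) [W.IsElliptic] [W.IsGloballyMinimal] [Fact (3 : ℕ).Prime], W.analyticRank = 0 → Summit.BirchSwinnertonDyer.Rank1Residual.Additive.ClassO6 W 3 → W.HasIrreducibleModPGaloisRep 3 → ¬ (∀ n : ℕ, W.HasSurjectiveModNGaloisRep (3 ^ n : ℕ)) → ¬ W.HasCM → (∃ (W₀ : WeierstrassCurve ℚ) (_ : W₀.IsElliptic) (_ : W₀.IsGloballyMinimal) (_ : NeZero (W₀.conductorNorm ℤ)) (D₀ : Literature.NumberTheory.EllipticCurves.ModularForms.ModularParametrizationData W₀ (W₀.conductorNorm ℤ)), WeierstrassCurve.IsIsogenous W W₀ ∧ (∀ z ∈ D₀.L.lattice, ∃ w ∈ Literature.NumberTheory.EllipticCurves.ModularForms.periodLattice D₀.f, z = (D₀.c : ℂ) * w) ∧ ((3 : ℤ) ∣ D₀.c ∨ (3 ∣ W₀.tamagawaProduct ∧ ¬ ∃ (q : ℕ) (_ : Fact q.Prime), q ∣ W₀.conductorNorm ℤ ∧ (q ≠ 3 → ¬ q ^ 2 ∣ W₀.conductorNorm ℤ ∧ ¬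 3 ∣ (W₀.baseChange ℚ_[3]).localTamagawaNumber ℤ_[3]) ∧ padicValNat 3 W₀.tamagawaProduct ≤ padicValNat 3 ((W₀.baseChange ℚ_[q]).localTamagawaNumber ℤ_[q])))) → ∀ (h32 : (3 : ℕ) ≠ 2) (κ : Literature.NumberTheory.EllipticCurves.ZpExtension ℚ 3) (hκ : κ.IsCyclotomic) [ContinuousSMul ℤ_[3] (W.tateModule 3)] [Module.Free ℤ_[3] (W.tateModule 3)] [Module.Finite ℤ_[3] (W.tateModule 3)] (γ : Field.absoluteGaloisGroup ℚ) (I : Literature.NumberTheory.EllipticCurves.Kato2004.IwasawaH1Data W 3 κ γ), κ.IsTopGenerator γ → ∀ {N : ℕ} [NeZero N] (f : CuspForm (CongruenceSubgroup.Gamma0 N) 2), Literature.NumberTheory.EllipticCurves.ModularForms.IsNewformOf W f → ∀ (ι : (m : ℕ) → (CyclotomicField m ℚ →+* ℂ)) (κ' : ℝ) (Λ' : ∀ (k : ℕ) (r : Finset (IsDedekindDomain.HeightOneSpectrum (NumberField.RingOfIntegers ℚ))), Literature.NumberTheory.GaloisRepresentations.H1 (Literature.NumberTheory.EllipticCurves.Kato2004.EulerSystemValues.tateRep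 W 3) (Literature.NumberTheory.EllipticCurves.Kato2004.EulerSystemValues.cycSubgroup 3 k r) →ₗ[ℤ_[3]] TensorProduct ℚ ℚ_[3] (CyclotomicField (Literature.NumberTheory.EllipticCurves.Kato2004.EulerSystemValues.cycLevel 3 k r) ℚ)) (c d a : ℤ) (A : ℕ), 0 < A → Int.gcd c (6 * 3 * A) = 1 → Int.gcd d (6 * 3 * N) = 1 → ∀ (z : ∀ (k : ℕ) (r : (Literature.NumberTheory.GaloisRepresentations.cyclotomicLevelsRat 3 (Literature.NumberTheory.EllipticCurves.Kato2004.EulerSystemValues.badPlaces c d A N)).Ideals), Literature.NumberTheory.GaloisRepresentations.H1 (Literature.NumberTheory.EllipticCurves.Kato2004.EulerSystemValues.tateRep W 3) ((Literature.NumberTheory.GaloisRepresentations.cyclotomicLevelsRat 3 (Literature.NumberTheory.EllipticCurves.Kato2004.EulerSystemValues.badPlaces c d A N)).level k r.1)) (x : ∀ (k : ℕ) (r : (Literature.NumberTheory.GaloisRepresentations.cyclotomicLevelsRat 3 (Literature.NumberTheory.EllipticCurves.Kato2004.EulerSystemValues.badPlaces c d A N)).Ideals), CyclotomicField (Literature.NumberTheory.EllipticCurves.Kato2004.EulerSystemValues.cycLevel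 3 k r.1) ℚ), Literature.NumberTheory.EllipticCurves.Kato2004.ZetaBody W 3 f ι κ' Λ' c d a A z x → ∀ (y : I.H), (∀ n : ℕ, I.proj n y = Literature.NumberTheory.EllipticCurves.Kato2004.levelToLayer W 3 hκ h32 (Literature.NumberTheory.EllipticCurves.Kato2004.EulerSystemValues.badPlaces c d A N) n (z (n + 1) (Literature.NumberTheory.GaloisRepresentations.cyclotomicLevelsRat 3 (Literature.NumberTheory.EllipticCurves.Kato2004.EulerSystemValues.badPlaces c d A N)).idealOne)) → y ≠ 0 → ∃ (s : I.H) (a : Literature.NumberTheory.EllipticCurves.IwasawaAlgebra 3), Literature.NumberTheory.EllipticCurves.Kato2004.IsEulerSystemClass W 3 κ γ I s ∧ s ∉ Literature.NumberTheory.EllipticCurves.IwasawaAlgebra.augIdealP 3 • (⊤ : Submodule (Literature.NumberTheory.EllipticCurves.IwasawaAlgebra 3) I.H) ∧ a • s = y) :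
    Summit.BirchSwinnertonDyer.BirchSwinnertonDyer.Theses.KatoDescentPotSupersingular.WildCoatesSujathaResidue :=
  wildCoatesSujathaResidue_of_katoZetaMultiple hIn.1 hIn.2 hZM

end Summit.BirchSwinnertonDyer.BirchSwinnertonDyer.Theorems
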